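import Summits.QuantumFields.YangMills.Theorems.BalabanUVNodesN06Ids3152AtPinsPhys
import Literature.MathematicalPhysics.QuantumFieldTheory.Balaban1983to89.Node00.OpsYOps312OfRecordPar

/-!
# BalabanUVNodes ∕ N06 ([B9], `Dag.B9_main`) — (3.124) AND (3.152) AT THE CERTIFICATE'S `𝔮`-GENERIC PINS FROM THE FIVE OPERATOR IDENTITIES:
# the `𝔮 ∕ par`-generic twin of ✓`N06Ids3152AtPinsPhys.ids3124_ids3152_of_hZ_pins` — the coordinate push that folds the knit certificate's `hidsK`

Track A of `YM-PLAN.md` (cell `pub-ymgap`, HUMAN RULING D-0062), node **N06** = [Balaban1985BackgroundPropagators] Thms 3.1–3.15; seat `pub-ymgap-dag-n06-d`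
(s2, «knit N06 at the ₁₁ record»), gen 27.  A HELPER for CASCADE-K «KE₄» (the stage-11 certificate at the knit letters, ✓`…N06AtOpsYSectEStKnitRecordKE2`).

WHAT.  The knit certificate («KC» ✓p795195 → «KE₁» ✓p795758 → «KE₂» ✓p796338) displays `hidsK : … → IsUnit Δ⁽¹⁾(U) → Ids3124 (𝔬12 x) U ∧ Ids3152 (𝔬12 x) (GcoS … (GpY
(parKnitY))) U` — (3.124) p.420 with its G₁-twins p.425 and (3.152) p.426 at the COORDINATE record `𝔬12` of node00-def-Y's knit Sect.-D letters (pins `hG1co12 hQco12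
hQsco12 hDvco12 hDvsco12 hRco12`, the `Q`-letters read by `QcoKHq ∕ QscoKHq` of `Node00.OpsYOps312OfRecordPar`).  node00-def-Y PROVED the five identities at the OPERATOR
letters of the knit record (✓`Node00.OpsYRecordV11Thresh.lettersYOfRecordV11K_ids3152_SU_threshK`: `R D* G₁ = R Γ D*`, `G₁ D R = D Γ R`, `Q G₁ D R = 0`, `R D* G₁ Q† = 0`,
`R D* G₁ D R = R` under (3.35), the x-free knit numerics and the (3.138) unit).  THIS FILE is the model-level push, GENERIC in the site transporter `par`, the averaging pair
`𝔮 ∕ 𝔮⋆` and the bond letter `G₁`: ★★ `ids3124_ids3152_of_ids_pinsQ` — the five operator identities (as ONE hypothesis `hids`, def-Y's printed 5-tuple shape) pushed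
through the readings `RcoK ∕ DvcoKH ∕ DvscoKH ∕ GcoK ∕ QcoKHq ∕ QscoKHq ∕ GcoS`, the scalars `c⁻¹ ∕ c ∕ η²c` cancelling exactly (§1 `gcoS_GpY_eq_coordOpK_GpPhysY_par`:
`GcoS … (GpY i par) = c • coordOpK (G′_phys(par))`), the chains re-associated by the functor calculus of `Node00.OpsYSectDCoords`.  The proof is the straight file's,
with `parSymY ↦ par`, `QY ∕ QsY (parBY) ↦ 𝔮 ∕ 𝔮⋆`, `G1Y … ↦ G₁` and the def-Y reduction replaced by the hypothesis.
HONEST FRAMING.  Kernel bookkeeping (finite-dimensional linear algebra over landed letters); nothing of [B9] asserted; COUNT-NEUTRAL; N06 NOT discharged.  One finite 𝕋⁴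
programme at fixed `ε` — NOT continuum, NOT OS, NOT the mass gap ∕ Clay.  0 `def`, 0 `sorry`, no `instance`, no `notation`.  NEW file.
RELATED, NOT DUPLICATED (searched 2026-08-31: `rg -l -w "N06Ids3152AtPinsPhysQ|ids3124_ids3152_of_ids_pinsQ|gcoS_GpY_eq_coordOpK_GpPhysY_par"` over `lean/{Summits,Literature,HarnessLib}` = ∅):
✓`N06Ids3152AtPinsPhys` (straight pair, `hZ`-keyed), node00-def-Y ✓`OpsYIds3152Reduction(Q)` ∕ ✓`OpsYRecordV11Thresh` (operator level).
-/

noncomputable section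

namespace Summit.QuantumFields.YangMills.BalabanUVNodes.N06Ids3152AtPinsPhysQ

open Literature.MathematicalPhysics.QuantumFieldTheory.Balaban1983to89
open Literature.MathematicalPhysics.QuantumFieldTheory.Balaban1983to89.Node00
open Literature.MathematicalPhysics.QuantumFieldTheory.Balaban1983to89.Node00.OpsYSectDCoords
open Literature.MathematicalPhysics.QuantumFieldTheory.Balaban1983to89.B6KLevelCensusIndexV1 (KIdx)
open Literature.MathematicalPhysics.QuantumFieldTheory.Balaban1983to89.B9CoReadingCoords (XBK coordOpK GcoK coordOpK_comp)
open Literature.MathematicalPhysics.QuantumFieldTheory.Balaban1983to89.B9CoReadingCoordsH (XHK coordOpKH coordOpK_comp_coordOpKH)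
open Literature.MathematicalPhysics.QuantumFieldTheory.Balaban1983to89.B9CoReadingCoordsS (XSK GcoS)
open Literature.MathematicalPhysics.QuantumFieldTheory.Balaban1983to89.B9CoReadingCoordsTranspose (TrIdx trBasis)
open Literature.MathematicalPhysics.QuantumFieldTheory.Balaban1983to89.B9Thm39ReadingCoords (cR39)
open Literature.MathematicalPhysics.QuantumFieldTheory.Balaban1983to89.B9Thm312Whole (Ops)
open Literature.MathematicalPhysics.QuantumFieldTheory.Balaban1983to89.B9Thm312WholeIdentitiesSplit (Ids3124)
open Literature.MathematicalPhysics.QuantumFieldTheory.Balaban1983to89.B9Thm313WholeRgdFrom3152 (Ids3152)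
open Literature.MathematicalPhysics.QuantumFieldTheory.Balaban1983to89.Node00 (deltaOneY G1Y)
open Literature.MathematicalPhysics.QuantumFieldTheory.Balaban1983to89.Node00.OpsYOps312OfRecordPar (QcoKHq QscoKHq)
open Literature.MathematicalPhysics.QuantumFieldTheory.Balaban1983to89.Node00 (SiteParY BondOpY)
open Literature.MathematicalPhysics.QuantumFieldTheory.Balaban1983to89.Node00.OpsYQLetter (QLetterY QsLetterY)
open Summit.QuantumFields.YangMills.BalabanUVNodes.N06Ids3152AtPinsPhys (coordOpKH_const_zero)
open scoped Matrix.Norms.L2Operator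

variable {N : ℕ} {d ℓ : ℕ} {hd : 1 ≤ d + 1} {hL : Odd (ℓ + 1) ∧ 1 < ℓ + 1} {b₀ b₁ : ℝ}

/-! ## §1 Two reading identities: the print-units G′ in the site model, the zero constant family -/

/-- `restrictScalars` of a real multiple written as a complex scalar. [cite: Balaban1985BackgroundPropagators, (3.25) p.394, dictionary] -/
private theorem rS_real_smul {𝔸 : Type} [NormedRing 𝔸] [NormedAlgebra ℂ 𝔸] {T₁ T₂ : Type} (r : ℝ) (f : (T₁ → 𝔸) →ₗ[ℂ] (T₂ → 𝔸)) :
    ((r : ℂ) • f).restrictScalars ℝ = r • f.restrictScalars ℝ := by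
  ext x t
  simp only [LinearMap.restrictScalars_apply, LinearMap.smul_apply, Pi.smul_apply, Complex.coe_smul]

/-- ★ **the knit's site model of `G′_latt` IS the `c`-scaled coordinate operator of `G′_phys`**: `GcoS … (GpY) U = c • coordOpK (G′_phys(U))` (the `η²` of `GcoS`
is the units factor `G′_phys = η²·G′_latt`). [cite: Balaban1985BackgroundPropagators, (3.25) p.394, (3.42) p.397, (3.119) p.419] -/
theorem gcoS_GpY_eq_coordOpK_GpPhysY_par (i : KIdx d ℓ hd hL b₀ b₁) (B : B9.Backgrounds) (cfg : B.Cfg → CfgY (Matrix (Fin N) (Fin N) ℂ) i)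
    (par : SiteParY (Matrix (Fin N) (Fin N) ℂ) i) (U₁ : B.Cfg) :
    GcoS i (trBasis N) B cfg (GpY i par) U₁ =
      cR39 (trBasis N) • coordOpK (trBasis N) (fun _ : Fin (d + 1) => (GpPhysY i par (cfg U₁)).restrictScalars ℝ) := by
  rw [GcoS, GpPhysY_apply, rS_real_smul, coordOpK_smul, smul_smul, mul_comm]

/-! ## §2 The push: `Ids3124 ∧ Ids3152` at the `𝔮`-generic pins from the five OPERATOR identities -/

/-- ★★ **(3.124) + ITS G₁-TWINS AND (3.152) AT THE CERTIFICATE'S `𝔮`-GENERIC PINS FROM THE FIVE OPERATOR IDENTITIES** (module docstring): for ANY site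
transporter `par`, ANY averaging pair `𝔮 ∕ 𝔮⋆` and ANY bond letter `G₁`, if the five operator identities `R D* G₁ = R Γ D*`, `G₁ D R = D Γ R`, `𝔮 G₁ D R = 0`,
`R D* G₁ 𝔮⋆ = 0`, `R D* G₁ D R = R` hold at `U := cfg U₁` (`Γ = G′_phys(par)`, `R = R(par, Γ)`) — node00-def-Y's ✓`lettersYOfRecordV11K_ids3152_SU_threshK` is exactly
this 5-tuple at the knit letters — then the coordinate record `𝔬` pinned by `hG1 hQ hQs hDv hDvs hR` satisfies `Ids3124 𝔬 U₁` and `Ids3152 𝔬 (GcoS … (GpY i par)) U₁`,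
all reading scalars `c⁻¹ ∕ c ∕ η²c` cancelling (`0 < N`).  The straight-pair special case is ✓`N06Ids3152AtPinsPhys.ids3124_ids3152_of_hZ_pins`.
[cite: Balaban1985BackgroundPropagators, (3.115) p.418, (3.124) p.420, p.425 («QG₁DR = QDG′R = 0»), (3.138) p.423, (3.151)–(3.152) p.426, (3.25) p.394] -/
theorem ids3124_ids3152_of_ids_pinsQ (i : KIdx d ℓ hd hL b₀ b₁) (B : B9.Backgrounds) (cfg : B.Cfg → CfgY (Matrix (Fin N) (Fin N) ℂ) i)
    {g : B9.Geometry} {Y : Type}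
    (𝔬 : Ops g B (XBK (TrIdx N) i) Y (XHK (TrIdx N) i) (XSK (TrIdx N) i)) (U₁ : B.Cfg) (hN : 0 < N)
    (par : SiteParY (Matrix (Fin N) (Fin N) ℂ) i) (𝔮 : QLetterY (Matrix (Fin N) (Fin N) ℂ) i) (𝔮s : QsLetterY (Matrix (Fin N) (Fin N) ℂ) i)
    (G₁ : BondOpY (Matrix (Fin N) (Fin N) ℂ) i)
    (hG1 : 𝔬.G1 U₁ = GcoK i (trBasis N) B cfg G₁ U₁)
    (hQ : 𝔬.Q U₁ = QcoKHq i (trBasis N) B cfg 𝔮 U₁) (hQs : 𝔬.Qstar U₁ = QscoKHq i (trBasis N) B cfg 𝔮s U₁)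
    (hDv : 𝔬.Dv U₁ = DvcoKH i (trBasis N) B cfg U₁) (hDvs : 𝔬.Dvstar U₁ = DvscoKH i (trBasis N) B cfg U₁)
    (hR : 𝔬.R U₁ = RcoK i (trBasis N) B cfg par (GpPhysY i par) U₁)
    (hids : (RY i par (GpPhysY i par) (cfg U₁) ∘ₗ divY i (cfg U₁) ∘ₗ G₁ (cfg U₁)
          = RY i par (GpPhysY i par) (cfg U₁) ∘ₗ GpPhysY i par (cfg U₁) ∘ₗ divY i (cfg U₁))
      ∧ (G₁ (cfg U₁) ∘ₗ gradY i (cfg U₁) ∘ₗ RY i par (GpPhysY i par) (cfg U₁)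
          = gradY i (cfg U₁) ∘ₗ GpPhysY i par (cfg U₁) ∘ₗ RY i par (GpPhysY i par) (cfg U₁))
      ∧ 𝔮 (cfg U₁) ∘ₗ G₁ (cfg U₁) ∘ₗ gradY i (cfg U₁) ∘ₗ RY i par (GpPhysY i par) (cfg U₁) = 0
      ∧ RY i par (GpPhysY i par) (cfg U₁) ∘ₗ divY i (cfg U₁) ∘ₗ G₁ (cfg U₁) ∘ₗ 𝔮s (cfg U₁) = 0
      ∧ RY i par (GpPhysY i par) (cfg U₁) ∘ₗ divY i (cfg U₁) ∘ₗ G₁ (cfg U₁) ∘ₗ gradY i (cfg U₁) ∘ₗ RY i par (GpPhysY i par) (cfg U₁)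
          = RY i par (GpPhysY i par) (cfg U₁)) :
    Ids3124 𝔬 U₁ ∧ Ids3152 𝔬 (GcoS i (trBasis N) B cfg (GpY i par)) U₁ := by
  have hc : cR39 (trBasis N) ≠ 0 := (cR39_trBasis_pos hN).ne'
  obtain ⟨h1, h2, h3, h4, h5⟩ := hids
  have e1 := congrArg (LinearMap.restrictScalars ℝ) h1
  have e2 := congrArg (LinearMap.restrictScalars ℝ) h2
  have e3 := congrArg (LinearMap.restrictScalars ℝ) h3
  have e4 := congrArg (LinearMap.restrictScalars ℝ) h4
  have e5 := congrArg (LinearMap.restrictScalars ℝ) h5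
  simp only [LinearMap.restrictScalars_zero] at e3 e4
  refine ⟨⟨?_, ?_, ?_⟩, ⟨?_, ?_⟩⟩
  · -- QG₁DR = 0
    rw [hQ, hG1, hDv, hR, QcoKHq, GcoK, DvcoKH, RcoK]
    simp only [LinearMap.comp_smul, LinearMap.smul_comp, smul_smul, inv_mul_cancel₀ hc, one_smul,
      coordOpKH_const_comp_coordOpK_const, coordOpK_const_comp_coordOpKH_const, coordOpKH_const_comp_coordOpKH_const]
    rw [show (fun _ : Fin (d + 1) => (𝔮 (cfg U₁)).restrictScalars ℝ ∘ₗ ((G₁ (cfg U₁)).restrictScalars ℝ ∘ₗ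
        ((gradY i (cfg U₁)).restrictScalars ℝ ∘ₗ (RY i par (GpPhysY i par) (cfg U₁)).restrictScalars ℝ))) = fun _ : Fin (d + 1) =>
        (𝔮 (cfg U₁) ∘ₗ G₁ (cfg U₁) ∘ₗ gradY i (cfg U₁) ∘ₗ
          RY i par (GpPhysY i par) (cfg U₁)).restrictScalars ℝ from rfl, e3, coordOpKH_const_zero, smul_zero]
  · -- RD*G₁Q* = 0
    rw [hR, hDvs, hG1, hQs, RcoK, DvscoKH, GcoK, QscoKHq]
    simp only [LinearMap.comp_smul, LinearMap.smul_comp, smul_smul, inv_mul_cancel₀ hc, one_smul,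
      coordOpK_const_comp_coordOpKH_const, coordOpKH_const_comp_coordOpKH_const]
    rw [show (fun _ : Fin (d + 1) => (RY i par (GpPhysY i par) (cfg U₁)).restrictScalars ℝ ∘ₗ ((divY i (cfg U₁)).restrictScalars ℝ ∘ₗ
        ((G₁ (cfg U₁)).restrictScalars ℝ ∘ₗ (𝔮s (cfg U₁)).restrictScalars ℝ))) = fun _ : Fin (d + 1) =>
        (RY i par (GpPhysY i par) (cfg U₁) ∘ₗ divY i (cfg U₁) ∘ₗ G₁ (cfg U₁) ∘ₗ
          𝔮s (cfg U₁)).restrictScalars ℝ from rfl, e4, coordOpKH_const_zero, smul_zero]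
  · -- RD*G₁DR = R
    rw [hR, hDvs, hG1, hDv, RcoK, DvscoKH, GcoK, DvcoKH]
    simp only [LinearMap.comp_smul, LinearMap.smul_comp, smul_smul, inv_mul_cancel₀ hc, one_smul,
      coordOpKH_const_comp_coordOpK_const, coordOpK_const_comp_coordOpKH_const, coordOpKH_const_comp_coordOpKH_const]
    rw [show (fun _ : Fin (d + 1) => (RY i par (GpPhysY i par) (cfg U₁)).restrictScalars ℝ ∘ₗ ((divY i (cfg U₁)).restrictScalars ℝ ∘ₗ
        ((G₁ (cfg U₁)).restrictScalars ℝ ∘ₗ ((gradY i (cfg U₁)).restrictScalars ℝ ∘ₗ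
          (RY i par (GpPhysY i par) (cfg U₁)).restrictScalars ℝ)))) = fun _ : Fin (d + 1) =>
        (RY i par (GpPhysY i par) (cfg U₁) ∘ₗ divY i (cfg U₁) ∘ₗ G₁ (cfg U₁) ∘ₗ
          gradY i (cfg U₁) ∘ₗ RY i par (GpPhysY i par) (cfg U₁)).restrictScalars ℝ from rfl, e5, coordOpKH_eq_coordOpK]
  · -- RD*G₁ = RΓD*
    rw [hR, hDvs, hG1, gcoS_GpY_eq_coordOpK_GpPhysY_par, RcoK, DvscoKH, GcoK]
    simp only [LinearMap.comp_smul, LinearMap.smul_comp, smul_smul, mul_inv_cancel₀ hc, one_smul,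
      coordOpKH_const_comp_coordOpK_const, coordOpK_const_comp_coordOpKH_const]
    rw [show (fun _ : Fin (d + 1) => (RY i par (GpPhysY i par) (cfg U₁)).restrictScalars ℝ ∘ₗ ((divY i (cfg U₁)).restrictScalars ℝ ∘ₗ
        (G₁ (cfg U₁)).restrictScalars ℝ)) = fun _ : Fin (d + 1) =>
        (RY i par (GpPhysY i par) (cfg U₁) ∘ₗ divY i (cfg U₁) ∘ₗ G₁ (cfg U₁)).restrictScalars ℝ
        from rfl, e1]
    rfl
  · -- G₁DR = DΓR
    rw [hG1, hDv, hR, gcoS_GpY_eq_coordOpK_GpPhysY_par, GcoK, DvcoKH, RcoK]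
    simp only [LinearMap.comp_smul, LinearMap.smul_comp, smul_smul, inv_mul_cancel₀ hc, one_smul,
      coordOpKH_const_comp_coordOpK_const, coordOpK_const_comp_coordOpKH_const, ← coordOpK_const_comp]
    rw [show (fun _ : Fin (d + 1) => (G₁ (cfg U₁)).restrictScalars ℝ ∘ₗ ((gradY i (cfg U₁)).restrictScalars ℝ ∘ₗ
        (RY i par (GpPhysY i par) (cfg U₁)).restrictScalars ℝ)) = fun _ : Fin (d + 1) =>
        (G₁ (cfg U₁) ∘ₗ gradY i (cfg U₁) ∘ₗ RY i par (GpPhysY i par) (cfg U₁)).restrictScalars ℝ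
        from rfl, e2]
    rfl

end Summit.QuantumFields.YangMills.BalabanUVNodes.N06Ids3152AtPinsPhysQ

end
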